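import Literature.MathematicalPhysics.QuantumFieldTheory.Balaban1983to89.B9Eq3133H1kPiTwoBackgroundLetterTower
import Literature.MathematicalPhysics.QuantumFieldTheory.Balaban1983to89.B9Eq3126H1kPiOneBlockColumn

/-!
# `Balaban1983to89.B9Eq3133H1kPiTwoBackgroundOneBlockColumn` — T. Bałaban, *Propagators for lattice gauge theories in a background field*, Commun. Math. Phys. **99** (1985)
# 389–434 [Balaban1985BackgroundPropagators] (3.126) p. 420 *«HB = GQ*(QGQ*)⁻¹B»*, (3.122) p. 420, (3.133) p. 422, Thm 3.4 p. 400; [Balaban1985Variational] (46) p. 285, (85)–(88)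
# p. 291, (103) p. 293, Prop. 6 (117) p. 295: **THE TWO-BACKGROUND ONE-BLOCK LETTER OF PRINT's `H̃_{1,k}` READ IN THE (115) CARRIERS, LATTICE-FREE** — for the block field `δ_yZ`
# supported at ONE coarse bond `y`, at every fine bond `b`:
# `‖(H̃_{1,k}(U)(δ_yZ))(b) − (H_{1,k}(1)(δ_yZ))(b)‖ ≤ (j₀ + α)·(M_φKM_φ′)·e^{−κ·d_m(Π(b₋), y₋)}·‖Z‖`, `∃ (α₁, j₁, K, κ)` BEFORE the lattice — gen 101's ladder
# `B9Eq3133H1kPiTwoBackgroundLetterTower.exists_letter_H1kPi_sub_flat` at the one-bond support through `B11Eq103H1Complex.H1CLM_apply` (the pattern of gen 97's one-background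
# `B9Eq3126H1kPiOneBlockColumn.exists_oneBlock_letter_H1LatticeCLM`); the letter `δhk(b, y)` of this generation's `B11Eq73KernelColumnsTwoBackgrounds` (its fine columns
# `δΘ = (j₀ + α)M_φKM_φ′·d·(L^{n+1})^d·K_d(κ)`, `δΘ^r` by `B9Eq3126H1kPiOneBlockColumn.sum_fine_{,weight_}exp_block_le`)

statement-level skeleton of published theorems with citation tags; proofs where landed; nothing here is a claim about the Yang–Mills mass gap

CITATION HEADER (lean-in-tree rule).  Audit cell `pub-balaban`, sub-cell `t4`, BINDER row NE9; NE9 crux-team LEAF PROVER 01 (`b2b-balaban-t4-ne9-formalise-leaf-01`, gen 105; ROUTE (J′),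
the `δ_W` brick; bears_on: R4/N22).  Composed BY NAME, nothing restated: `exists_letter_H1kPi_sub_flat` (gen 101), `B11Eq103H1Complex.{H1LatticeCLM, H1CLM, funEquiv}`.  Sources read
through the audited headers of those files (`paper:balaban1985-cmp99-background-propagators` pp. 400, 420–422; `paper:balaban1985-cmp102-variational-background` pp. 285, 291, 293, 295).
NOTHING of print's proof is reproduced: [folklore] one reading of a landed ladder at a one-bond support.

WHAT IS PROVED (sorry-free; proof lane — no `def`).  **`exists_oneBlock_letter_H1LatticeCLM_sub_flat`** — `∃ α₁ j₁ K κ` BEFORE the binder block of `exists_letter_H1kPi_sub_flat`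
VERBATIM through `hpos₁` (+ `[Fact (0 < η)]`, `hQ1`), then for every carrier data `(lev₀ lev₁ Dc₁ Dc₂ levB)`, every coarse bond `y`, fibre value `Z` and fine bond `b`: the display above,
`H̃_{1,k}(U) = H1LatticeCLM φ hposπ hQ lev₁ Dc₁`, `H_{1,k}(1) = H1LatticeCLM (flat data) φ hpos₁ hQ1 lev₁ Dc₂` (= `H̃_{1,k}(1)`, `B9Eq3119DeltaPiTowerFlat`).
HONEST SCOPE.  Composition BY NAME on the cell's MODEL rows (O-NE9-1; #5 UNRULED); constants crude; first order at the flat point; `j₀` and `α` displayed separately; the windows,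
`c₀ = η^d`, unitarity, the tower data, the positivity and onto witnesses at `U` and at `1` stay HYPOTHESES; nothing of [B9] (3.126) ∕ Thm 3.4 or [B11] (46), (117) asserted as printed;
«NE9 ⇐ the named binders»; NE9 NOT PRINTED ∕ NOT PROVED; spine PROVED 0∕9; rung (B)+1 finite T⁴ — NOT infinite volume, NOT mass gap, NOT BetaPertH, NOT Clay.  HONEST DEPENDENCY:
continuum YM on T⁴ ⇐ BetaPertH ∧ nine spine estimates (0/9 proved); BetaPertH ⇐ (D1) ∧ (D4) ∧ CAP+tail; G-an2-4 gates asym, D1 and NE2/3/4.  NEW file; nothing modified.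
Net new unproved facts: 0.
-/

noncomputable section

open scoped InnerProductSpace ComplexConjugate BigOperators

namespace Literature.MathematicalPhysics.QuantumFieldTheory.Balaban1983to89.B9Eq3133H1kPiTwoBackgroundOneBlockColumn

open B4Sect5Torus (TSite tdist tdist_nonneg)
open B9SectCLatticeCarrier (Bond bpos shift unshift shift_unshift)
open B9Eq311L2Pairing (WL2)
open B9Eq319QprimeTorus (blockCoord)
open B7Prop1Explicit (U1 Wcx boxVec)
open B11Eq103H1Complex (SiteL2K BondL2K H1LatticeK H1LatticeCLM H1CLM funEquiv funEquiv_symm_apply)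
open B9Eq310DeltaPrime (plaqHolU)
open B9Eq310HessianOperator (adTransportW hessOp)
open B9Eq315QTorus (perCfg cornerSite)
open B9Eq315QTower (towerP UlevOf)
open B9Eq315QTowerFlat (perCfg_UlevOf_one_mem_U1 norm_Wcx_UlevOf_one_sub_one_le)
open B9Eq316TowerFlatIsOneStep (towerP_eq_fineP_pow siteCast)
open B9Eq326OperatorTower (QkW laplaceAk G1k H1k RofUk)
open B9Eq324DeltaPrimeATower (laplacePrimeAk)
open B9Eq3119DeltaPiTower (laplaceAkPi)
open B9Eq3133H1kPiTwoBackgroundLetterTower (exists_letter_H1kPi_sub_flat)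
open B11Eq115Space

variable {d : ℕ} (hd : 1 ≤ d) (L : ℕ) [NeZero L] (hL : 1 ≤ L) (hL3 : 3 ≤ L)
  {𝔸 : Type*} [NormedRing 𝔸] [NormedAlgebra ℂ 𝔸] [CompleteSpace 𝔸] [NormOneClass 𝔸] [StarRing 𝔸] [NormedStarGroup 𝔸] [StarModule ℂ 𝔸] [FiniteDimensional ℂ 𝔸]
  {W : Type*} [NormedAddCommGroup W] [InnerProductSpace ℂ W] [FiniteDimensional ℂ W] (φ : W ≃ₗ[ℂ] 𝔸)
  {Mφ Mφ' : ℝ} (hMφ : 0 ≤ Mφ) (hMφ' : 0 ≤ Mφ') (hφ : ∀ w, ‖φ w‖ ≤ Mφ * ‖w‖) (hφ' : ∀ X, ‖φ.symm X‖ ≤ Mφ' * ‖X‖) (hstar : ∀ X : 𝔸, ‖star X‖ ≤ ‖X‖)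
  {a : ℝ} (ha : 0 < a) {a' : ℝ} (ha' : 0 < a') {ϱ : ℝ} (hϱ0 : 0 ≤ ϱ) (hϱ1 : ϱ < 1)
  (τ : 𝔸 →ₗ[ℂ] ℂ) {Cτ : ℝ} (hτ : ∀ X, ‖τ X‖ ≤ Cτ * ‖X‖) (hCτ : 0 ≤ Cτ) {Mτ : ℝ} (hτm : ∀ X Y : 𝔸, ‖τ (X * Y)‖ ≤ Mτ * ‖X‖ * ‖Y‖) (hMτ : 0 ≤ Mτ)
  {ρw : ℝ} (hρw : 0 ≤ ρw)
  (hτ₁ : ∀ X : 𝔸, τ (star X) = conj (τ X)) (hτ₂ : ∀ X Y : 𝔸, τ (X * Y) = τ (Y * X)) (hφτ : ∀ X Y : 𝔸, ⟪φ.symm X, φ.symm Y⟫_ℂ = τ (star X * Y))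
  (AQ : ℝ)
  {ι : Type} [Fintype ι] [DecidableEq ι] (b : Module.Basis ι ℝ 𝔸) {M₂ : ℝ} (hM₂ : 0 ≤ M₂) (hrepr : ∀ (v : 𝔸) (i : ι), |b.repr v i| ≤ M₂ * ‖v‖)


/-! ## The two-background one-block letter of `H̃_{1,k}` in the (115) carriers, lattice-free -/

include hd hL hL3 hMφ hMφ' hφ hφ' hstar ha ha' hϱ0 hϱ1 hτ hCτ hτm hMτ hρw hτ₁ hτ₂ hφτ hM₂ hrepr in
set_option maxHeartbeats 3200000 in
set_option maxRecDepth 8192 in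
/-- **THE TWO-BACKGROUND ONE-BLOCK LETTER OF `H̃_{1,k}` IN THE (115) CARRIERS** — see the module docstring: for the block field `δ_yZ` supported at ONE coarse bond `y`,
`‖(H̃_{1,k}(U)(δ_yZ))(b) − (H_{1,k}(1)(δ_yZ))(b)‖ ≤ (j₀ + α)·(M_φKM_φ′)·e^{−κ·d_m(Π(b₋), y₋)}·‖Z‖`, `∃ (α₁, j₁, K, κ)` BEFORE the lattice; the letter `δhk(b, y)` of
`B11Eq73KernelColumnsTwoBackgrounds`. [folklore]
[cite: Balaban1985BackgroundPropagators, (3.126) p.420, (3.122) p.420, (3.133) p.422, Thm 3.4 p.400; Balaban1985Variational, (46) p.285, (85) p.291, (103) p.293, (117) p.295] -/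
theorem exists_oneBlock_letter_H1LatticeCLM_sub_flat [Fact (0 < (L : ℝ))] :
    ∃ α₁ j₁ K κ : ℝ, 0 < α₁ ∧ 0 < j₁ ∧ 0 ≤ K ∧ 0 < κ ∧
      ∀ (n : ℕ) (η : ℝ) [Fact (0 < η)] (_hηL : η * (L : ℝ) ^ (n + 1) = 1) (c₀ c₁ : ℝ) [Fact (0 < c₀)] [Fact (0 < c₁)]
        (_hw : c₀ * ((L : ℝ) ^ (n + 1)) ^ d = c₁) (_hρ : |η| ^ d / c₀ ≤ ρw) (m : Fin d → ℕ) [∀ i, NeZero (m i)] (_hm : ∀ i, 1 ≤ m i)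
        (U : Bond d (towerP L m (n + 1)) → 𝔸ˣ) (αU : ℕ → ℝ) (_hα0 : ∀ j, 0 ≤ αU j) (hα1 : ∀ j, αU j ≤ 1 / 64)
        (hαL : ∀ j, 50 * (d + 1) * αU j * (L : ℝ) ^ d ≤ 1 / 2)
        (hU1 : ∀ (j : ℕ) (x : B7Prop1Explicit.Site d) (k : Fin d), perCfg (towerP L m (j + 1)) (UlevOf L m (n + 1) U j) x k ∈ U1 𝔸)
        (hreg : ∀ (j : ℕ) (y : TSite d (towerP L m j)) (k : Fin d) (ρ' : Fin d → Fin L),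
          ‖((Wcx L (perCfg (towerP L m (j + 1)) (UlevOf L m (n + 1) U j)) (cornerSite L y) k (boxVec L ρ') : 𝔸ˣ) : 𝔸) - 1‖ ≤ αU j)
        (εU : ℕ → ℝ) (_hεU : ∀ j, 0 ≤ εU j) (_hε1 : ∀ j, εU j ≤ 1) (_hUε : ∀ (j : ℕ) (b : Bond d (towerP L m (j + 1))), ‖(UlevOf L m (n + 1) U j b : 𝔸) - 1‖ ≤ εU j)
        (_hLb : ∀ (j : ℕ) (b : Bond d (towerP L m (j + 1))), UlevOf L m (n + 1) U j b ∈ U1 𝔸)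
        (α : ℝ) (_hα : 0 ≤ α) (_hαle : α ≤ α₁)
        (hUst : ∀ b, star (U b : 𝔸) = (((U b)⁻¹ : 𝔸ˣ) : 𝔸)) (_hUb : ∀ b, U b ∈ U1 𝔸) (_hUη : ∀ b, ‖(U b : 𝔸) - 1‖ ≤ α * η)
        (_hUw : ∀ (x : TSite d (towerP L m (n + 1))) (μ ν : Fin d), ‖(U (shift ν x, μ) : 𝔸) - (U (x, μ) : 𝔸)‖ ≤ α * η ^ 2)
        (_hpl : ∀ p : B9SectCLatticeCarrier.Plaq d (towerP L m (n + 1)), ‖(plaqHolU U p : 𝔸) - 1‖ ≤ α * η ^ 2)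
        (_hUgrad : ∀ (x : TSite d (towerP L m (n + 1))) (μ : Fin d), ‖(U (x, μ) : 𝔸) - U (unshift μ x, μ)‖ ≤ α * η ^ 2)
        (_hRlev : ∀ (j : ℕ) (b : Bond d (towerP L m (j + 1))) (w : W), ‖adTransportW φ (UlevOf L m (n + 1) U j) b w‖ ≤ ‖w‖)
        (_hεg : ∀ j < n + 1, εU j ≤ α * ϱ ^ j) (_hAQ : ∑ j ∈ Finset.range (n + 1), αU j ≤ AQ)
        (hpos' : ∀ x : SiteL2K ℂ d (towerP L m (n + 1)) c₀ W, x ≠ 0 → 0 < RCLike.re ⟪x, laplacePrimeAk L m n φ η U a' (c₁ := c₁) x⟫_ℂ)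
        (hpos : ∀ x : BondL2K ℂ d (towerP L m (n + 1)) c₀ W, x ≠ 0 →
          0 < RCLike.re ⟪x, laplaceAk L m n φ η U hL αU hα1 hU1 hreg τ (c₀ := c₀) (c₁ := c₁) a x⟫_ℂ)
        (_hc₀η : c₀ = η ^ d) (j₀ : ℝ) (_hJ : ∀ μ y, ‖B9Eq39Adjoint.J (fun μ => B9Eq33CovDerivVector.shiftEquiv μ) (fun μ y => U (y, μ)) η μ y‖ ≤ j₀) (_hj : j₀ ≤ j₁)
        (hposπ : ∀ x : BondL2K ℂ d (towerP L m (n + 1)) c₀ W, x ≠ 0 →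
          0 < RCLike.re ⟪x, laplaceAkPi L m n φ τ η U a' hpos' hL αU hα1 hU1 hreg (c₁ := c₁) a x⟫_ℂ)
        (hQ : Function.Surjective (QkW L m n φ U hL αU hα1 hU1 hreg (c₀ := c₀) (c₁ := c₁)))
        (hpos'₁ : ∀ x : SiteL2K ℂ d (towerP L m (n + 1)) c₀ W, x ≠ 0 →
          0 < RCLike.re ⟪x, laplacePrimeAk L m n φ η (fun _ : Bond d (towerP L m (n + 1)) => (1 : 𝔸ˣ)) a' (c₁ := c₁) x⟫_ℂ)
        (hpos₁ : ∀ x : BondL2K ℂ d (towerP L m (n + 1)) c₀ W, x ≠ 0 →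
          0 < RCLike.re ⟪x, laplaceAk L m n φ η (fun _ : Bond d (towerP L m (n + 1)) => (1 : 𝔸ˣ)) hL (fun _ => 0) (fun _ => by norm_num)
            (perCfg_UlevOf_one_mem_U1 L m (n + 1)) (norm_Wcx_UlevOf_one_sub_one_le L m (n + 1) (fun _ => 0) (fun _ => le_rfl)) τ
            (c₀ := c₀) (c₁ := c₁) a x⟫_ℂ)
        (hQ1 : Function.Surjective (QkW L m n φ (fun _ : Bond d (towerP L m (n + 1)) => (1 : 𝔸ˣ)) hL (fun _ => 0) (fun _ => by norm_num)
          (perCfg_UlevOf_one_mem_U1 L m (n + 1)) (norm_Wcx_UlevOf_one_sub_one_le L m (n + 1) (fun _ => 0) (fun _ => le_rfl)) (c₀ := c₀) (c₁ := c₁)))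
        (lev₀ : Bond d (towerP L m (n + 1)) → ℕ) {κ' : Type*} [Fintype κ'] (lev₁ : κ' → ℕ)
        (Dc₁ Dc₂ : (Bond d (towerP L m (n + 1)) → 𝔸) →ₗ[ℂ] (κ' → 𝔸)) (levB : Bond d m → ℕ)
        (y : Bond d m) (Z : 𝔸) (bd : Bond d (towerP L m (n + 1))),
        ‖JetSup.equiv (levWeight (L : ℝ) η lev₀ 1) (levWeight (L : ℝ) η lev₁ 2) Dc₁
            (H1LatticeCLM (L := (L : ℝ)) (η := η) (lev₀ := lev₀) (levB := levB) φ hposπ hQ lev₁ Dc₁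
              ((NegSup.equiv (levWeight (L : ℝ) η levB 0) 𝔸).symm (Pi.single y Z))) bd -
          JetSup.equiv (levWeight (L : ℝ) η lev₀ 1) (levWeight (L : ℝ) η lev₁ 2) Dc₂
            (H1LatticeCLM (L := (L : ℝ)) (η := η) (lev₀ := lev₀) (levB := levB) (c := ((η : ℂ))⁻¹)
              (R := adTransportW φ (fun _ : Bond d (towerP L m (n + 1)) => (1 : 𝔸ˣ)))
              (S := adTransportW φ fun _ : Bond d (towerP L m (n + 1)) => (1 : 𝔸ˣ)⁻¹) (Δ₁ := hessOp φ η (fun _ : Bond d (towerP L m (n + 1)) => (1 : 𝔸ˣ)) τ)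
              (Rr := RofUk L m n φ η (fun _ : Bond d (towerP L m (n + 1)) => (1 : 𝔸ˣ)))
              (Q := (QkW L m n φ (fun _ : Bond d (towerP L m (n + 1)) => (1 : 𝔸ˣ)) hL (fun _ => 0) (fun _ => by norm_num)
                (perCfg_UlevOf_one_mem_U1 L m (n + 1)) (norm_Wcx_UlevOf_one_sub_one_le L m (n + 1) (fun _ => 0) (fun _ => le_rfl)) (c₀ := c₀) (c₁ := c₁))) (a := a)
              φ hpos₁ hQ1 lev₁ Dc₂ ((NegSup.equiv (levWeight (L : ℝ) η levB 0) 𝔸).symm (Pi.single y Z))) bd‖ ≤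
          (j₀ + α) * (Mφ * K * Mφ') *
            Real.exp (-(κ * tdist m (blockCoord (L ^ (n + 1)) m (siteCast (towerP_eq_fineP_pow L m (n + 1)) (bpos bd))) (bpos y))) * ‖Z‖ := by
  classical
  obtain ⟨α₁, j₁, K, κ, hα₁, hj₁, hK, hκ, HK⟩ :=
    exists_letter_H1kPi_sub_flat hd L hL hL3 φ hMφ hMφ' hφ hφ' hstar ha ha' hϱ0 hϱ1 τ hτ hCτ hτm hMτ hρw hτ₁ hτ₂ hφτ AQ b hM₂ hrepr
  refine ⟨α₁, j₁, K, κ, hα₁, hj₁, hK, hκ, ?_⟩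
  intro n η _ hηL c₀ c₁ _ _ hw hρ m _ hm U αU hα0 hα1 hαL hU1 hreg εU hεU hε1 hUε hLb α hα hαle hUst hUb hUη hUw hpl hUgrad hRlev hεg hAQ hpos' hpos hc₀η j₀ hJ hj
    hposπ hQ hpos'₁ hpos₁ hQ1 lev₀ κ' _ lev₁ Dc₁ Dc₂ levB y Z bd
  -- the one-block field read in the Hilbert fibre: supported at `y₋`, values bounded by `M_φ′‖Z‖`
  have hzv : ∀ c', bpos c' ≠ bpos y → WL2.equiv ℂ (fun _ : Bond d m => c₁) W
      ((funEquiv φ (fun _ : Bond d m => c₁)).symm (Pi.single y Z)) c' = 0 := by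
    intro c' hc'
    have hne : c' ≠ y := fun h => hc' (by rw [h])
    rw [funEquiv_symm_apply, Pi.single_eq_of_ne hne, map_zero]
  have hzF : ∀ c', ‖WL2.equiv ℂ (fun _ : Bond d m => c₁) W ((funEquiv φ (fun _ : Bond d m => c₁)).symm (Pi.single y Z)) c'‖ ≤ Mφ' * ‖Z‖ := by
    intro c'
    rw [funEquiv_symm_apply]
    refine (hφ' _).trans (mul_le_mul_of_nonneg_left ?_ hMφ')
    by_cases h : c' = y
    · rw [h, Pi.single_eq_same]
    · rw [Pi.single_eq_of_ne h, norm_zero]; exact norm_nonneg _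
  have h := HK n η hηL c₀ c₁ hw hρ m hm U αU hα0 hα1 hαL hU1 hreg εU hεU hε1 hUε hLb α hα hαle hUst hUb hUη hUw hpl hUgrad hRlev hεg hAQ hpos' hpos hc₀η j₀ hJ hj
    hposπ hQ hpos'₁ hpos₁ (bpos y) ((funEquiv φ (fun _ : Bond d m => c₁)).symm (Pi.single y Z)) (Mφ' * ‖Z‖) hzv hzF bd
  -- both letters unfold (`H1CLM_apply`) to `φ` of the Hilbert-level operators applied to the SAME one-block field
  have e₁ : JetSup.equiv (levWeight (L : ℝ) η lev₀ 1) (levWeight (L : ℝ) η lev₁ 2) Dc₁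
      (H1LatticeCLM (L := (L : ℝ)) (η := η) (lev₀ := lev₀) (levB := levB) φ hposπ hQ lev₁ Dc₁
        ((NegSup.equiv (levWeight (L : ℝ) η levB 0) 𝔸).symm (Pi.single y Z))) bd =
      φ (WL2.equiv ℂ (fun _ : Bond d (towerP L m (n + 1)) => c₀) W (H1LatticeK hposπ hQ
        ((funEquiv φ (fun _ : Bond d m => c₁)).symm (Pi.single y Z))) bd) := rfl
  have e₂ : JetSup.equiv (levWeight (L : ℝ) η lev₀ 1) (levWeight (L : ℝ) η lev₁ 2) Dc₂
      (H1LatticeCLM (L := (L : ℝ)) (η := η) (lev₀ := lev₀) (levB := levB) (c := ((η : ℂ))⁻¹)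
        (R := adTransportW φ (fun _ : Bond d (towerP L m (n + 1)) => (1 : 𝔸ˣ)))
        (S := adTransportW φ fun _ : Bond d (towerP L m (n + 1)) => (1 : 𝔸ˣ)⁻¹) (Δ₁ := hessOp φ η (fun _ : Bond d (towerP L m (n + 1)) => (1 : 𝔸ˣ)) τ)
        (Rr := RofUk L m n φ η (fun _ : Bond d (towerP L m (n + 1)) => (1 : 𝔸ˣ)))
        (Q := (QkW L m n φ (fun _ : Bond d (towerP L m (n + 1)) => (1 : 𝔸ˣ)) hL (fun _ => 0) (fun _ => by norm_num)
          (perCfg_UlevOf_one_mem_U1 L m (n + 1)) (norm_Wcx_UlevOf_one_sub_one_le L m (n + 1) (fun _ => 0) (fun _ => le_rfl)) (c₀ := c₀) (c₁ := c₁))) (a := a)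
        φ hpos₁ hQ1 lev₁ Dc₂ ((NegSup.equiv (levWeight (L : ℝ) η levB 0) 𝔸).symm (Pi.single y Z))) bd =
      φ (WL2.equiv ℂ (fun _ : Bond d (towerP L m (n + 1)) => c₀) W
        (H1k L m n φ η (fun _ : Bond d (towerP L m (n + 1)) => (1 : 𝔸ˣ)) hL (fun _ => 0) (fun _ => by norm_num)
            (perCfg_UlevOf_one_mem_U1 L m (n + 1)) (norm_Wcx_UlevOf_one_sub_one_le L m (n + 1) (fun _ => 0) (fun _ => le_rfl)) τ (c₀ := c₀) (c₁ := c₁)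
            (fun _ => by norm_num) hpos₁
          ((funEquiv φ (fun _ : Bond d m => c₁)).symm (Pi.single y Z))) bd) := rfl
  rw [e₁, e₂, ← map_sub, ← Pi.sub_apply, ← WL2.equiv_sub]
  refine (hφ _).trans ?_
  calc Mφ * ‖WL2.equiv ℂ (fun _ : Bond d (towerP L m (n + 1)) => c₀) W (H1LatticeK hposπ hQ ((funEquiv φ (fun _ : Bond d m => c₁)).symm (Pi.single y Z)) -
          H1k L m n φ η (fun _ : Bond d (towerP L m (n + 1)) => (1 : 𝔸ˣ)) hL (fun _ => 0) (fun _ => by norm_num)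
            (perCfg_UlevOf_one_mem_U1 L m (n + 1)) (norm_Wcx_UlevOf_one_sub_one_le L m (n + 1) (fun _ => 0) (fun _ => le_rfl)) τ (c₀ := c₀) (c₁ := c₁)
            (fun _ => by norm_num) hpos₁ ((funEquiv φ (fun _ : Bond d m => c₁)).symm (Pi.single y Z))) bd‖
      ≤ Mφ * ((j₀ + α) * K * Real.exp (-(κ * tdist m (blockCoord (L ^ (n + 1)) m (siteCast (towerP_eq_fineP_pow L m (n + 1)) (bpos bd))) (bpos y))) * (Mφ' * ‖Z‖)) :=
        mul_le_mul_of_nonneg_left h hMφ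
    _ = _ := by ring

end Literature.MathematicalPhysics.QuantumFieldTheory.Balaban1983to89.B9Eq3133H1kPiTwoBackgroundOneBlockColumn

end
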